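import Summits.QuantumFields.YangMills.Theorems.BalabanUVNodesN21ChiSlotCubeGeometry
import Literature.MathematicalPhysics.QuantumFieldTheory.Balaban1983to89.B15Claim189CubePin

/-!
# N21 (NE7c), strategy s3 «alternative currency», file 30 — TORUS COLLARS, BLOCKS, AND THE SUPPORT OF THE AVERAGING INPUTS: the fine bonds
# feeding the NEAR data of `𝐁_k(Ω)`, `Ω = π(cubeExt s c w)`, have their sources in `π(cubeExt s c (w + 4L^k − 1))` — part 1 of the (DISJ)
# SUPPORT LEMMA (part 2 = file 31 `…N21ReadSetDisj`: the read set `liftIter k (inputs (near 𝐁_k(□_c^{≈4})))` is carried by `□_c^{≈7}`,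
# hence 28 ∕ 29's displayed binder `hdisj` ∕ `hoff` is a theorem for every fibre `fib ⊆ bondsMeeting k Z` with `Z ∩ □_c^{≈7} = ∅`)

HEADER — WORK-UNIT METADATA.  Seat `pub-ymgap-dag-n21-e` (R141 (C) fan-out, node N21 = NE7c, strategy s3), g10, file 30; sequel of file 29
(`…N21ChiSlotCubeGeometry`, p531762: `hgeom` discharged, (DISJ) left displayed — its (G6′) names the comparison point) and of file 28
(`…RStepLocalityBgN`, p529659).  Lane: `--kind proof --supports stmt-QuantumFields-20509 --as helper` (K3⁶ `SpineGivenEndpointR13SepCoPR`,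
dag-lead WORDS-142 ∕ director-ym №179 «KEY-22 IS SERVED»).  Count-neutral.

THE CONTENT ([folklore] lattice geometry over r11 ∕ def-R letters; every «within distance» sentence is typed TORUS-HONESTLY as membership in a
pushed-forward collar `cover P '' cubeExt s c w` of the universal cover, so that deck transformations never need a case split).
§1 Collars: `cubeExt` is monotone and absorbs `Within`; ON THE TORUS a point within `t` (on the cover) of a point of `π(cubeExt s c w)` lies in
   `π(cubeExt s c (w+t))` (★ `cover_mem_collar_of_within`); one lattice step costs one unit (`B15Claim189CubePin.cover_add_single` by name;
   `shift_mem_collar`, `mem_collar_of_shift_mem`); unit steps are injective (`eq_of_shift_eq`).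
§2 Blocks: two fine sites with the same `j`-block label have standard lifts in one `L^j`-cube (`within_lift_of_blockIter_eq`, r11
   `val_blockIter`); the representative `embIter j y` lies in the block of `y` (`blockIter_embIter`, `TorusGeometry`'s `Site.blockOf_emb`); ★ the
   `L^j`-TRANSLATE of a block is the block of the shifted label: `blockIter j (π(x + L^j e_μ)) = (blockIter j (π x)) + e_μ`
   (`blockIter_cover_add_single` ∕ `_sub_single`, the one `ZMod` computation of the file: `N₀ = L^j·N_j`).
§3 The averaging inputs: every fine bond of `feeds j b` ((2.11), `B14Eq216Concrete`) has its source within `2L^j − 2` of a point of the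
   `j`-block of `b₋` (★ `feeds_witness`, induction over `mem_feeds_succ`; the case `B(b′₋) = b₊` is the `L^{j+1}`-translate of §2); hence in
   `π(cubeExt s c (w + 4L^j − 3))` whenever the representative of `b₋` or of `b₊` lies in `π(cubeExt s c w)` (`src_mem_collar_of_feeds`);
   a positive layer `Γ_{i+1} ⊆ Ω^{(i+1)}` of `𝐁_k(Ω)` (`Bj_subset_pts`; empty above `k`, `Bj_of_gt`) gives `src_mem_collar_of_feeds_Bj_succ`;
   plaquette corners (`plaq_src_mem_collar`, `plaqBonds_ends_mem_collar`); and ★★ `src_mem_collar_of_inputs_near_Bj`: for `0 < k ≤ m + K`,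
   `1 ≤ M₁`, every fine bond of `inputs (near 𝐁_k(Ω))` has its source in `π(cubeExt s c (w + 4L^k − 1))` — layer `0` = the near `Γ₀`-sites,
   `Γ₀ = Ω₁ᶜ` (`Bj_zero`): a site of a plaquette having a bond inside `Ω₁ ⊆ Ω` (`maxDomT_subset`), or an endpoint of a feeding bond
   (`nearSites`' two clauses, `mem_inputsPos`).

HONEST FRAMING.  NE7c is NOT PRINTED and NOT PROVED.  Pure bookkeeping toward the (DISJ) side condition of the (LOC) road (22c ∕ 28 ∕ 29),
completed in file 31; nothing of Bałaban's asserted; N21 NOT discharged; counts UNMOVED; count-neutral; one finite 𝕋⁴ at fixed `ε`; NOT ℝ⁴ ∕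
OS ∕ mass gap ∕ Clay.

CITATION HEADER (lean-in-tree rule 2026-08-18).  BY NAME: r11 `B14.Eq216Concrete.feeds` ∕ `feeds_zero` ∕ `mem_feeds_succ` ∕ `inputs` ∕ `mem_inputs`;
`B14.Eq12InteriorLocality.near` ∕ `near_zero` ∕ `near_succ` ∕ `nearSites` ∕ `inputsPos` ∕ `mem_inputsPos` ∕ `extBonds` ∕ `plaqBonds` ∕ `mem_plaqBonds`;
`B14.Eq213DetSet.Bj` ∕ `Bj_zero` ∕ `Bj_subset_pts` ∕ `Bj_of_gt` ∕ `maxDomT_subset` ∕ `val_blockIter`; `B14.Eq22Determines.blockIter`; `B15DeterminingSets.bondsOf` ∕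
`pts` ∕ `mem_pts` ∕ `embIter`; `B15Eq112TorusCover.cover` ∕ `lift` ∕ `per` ∕ `cover_lift` ∕ `cover_add_pmul` ∕ `cover_eq_cover_iff`; `B15LatticeCubeTorus.pmul`;
`B14DomainGeom.Within` (`refl` ∕ `mono` ∕ `triangle` ∕ `symm`); `B14.Eq213MaximalDomains.cubeExt`; `TorusGeometry`'s `Site.blockOf_emb`; `Site.shift_apply`;
`B10StarCount.unshift_shift`; `B15Claim189CubePin.cover_add_single` (Claim (1.89) cube-pin module).  Context only (SHAPE, nothing asserted): [Balaban1987RG1] (0.1) pp. 251–252; [Balaban1988Convergent] (1.3) p. 246, (2.2) p. 255,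
(2.11) p. 256, (2.16) p. 257.
-/

set_option autoImplicit false

open Set

namespace Summit.QuantumFields.YangMills.Theorems.N21ReadSetSupport

open Literature.MathematicalPhysics.QuantumFieldTheory.Balaban1983to89
open B15DeterminingSets B14.Eq213DetSet B14.Eq216Concrete B14.Eq12InteriorLocality B14.Eq213MaximalDomains B15Eq112TorusCover B14DomainGeom
open B15LatticeCubeTorus (pmul)
open B14.Eq22Determines (blockIter blockIter_zero blockIter_succ)

/-! ## §1 Collars on the cover and on the torus -/

section Collars

variable {d : ℕ}

/-- (S1) Collars are monotone in the width. [folklore] -/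
theorem cubeExt_mono (s : ℕ) (a : Pt d) {w w' : ℤ} (h : w ≤ w') : cubeExt s a w ⊆ cubeExt s a w' := by
  intro z hz i
  have h1 := hz i
  exact ⟨by linarith [h1.1], by linarith [h1.2]⟩

/-- (S1′) A point within `t` of a point of the `w`-collar lies in the `(w + t)`-collar (sup-metric boxes). [folklore] -/
theorem mem_cubeExt_of_within (s : ℕ) (a : Pt d) {w t : ℤ} {x x' : Pt d} (hx : x ∈ cubeExt s a w) (h : Within t x x') :
    x' ∈ cubeExt s a (w + t) := by
  intro i
  have h1 := hx i
  have h2 := h i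
  rw [abs_le] at h2
  exact ⟨by linarith [h1.1, h2.1, h2.2], by linarith [h1.2, h2.1, h2.2]⟩

/-- (S1″) One coordinate step of length `t ≥ 0` is within `t`. [folklore] -/
theorem within_add_single (x : Pt d) (μ : Fin d) {t : ℤ} (ht : 0 ≤ t) : Within t x (x + Pi.single μ t) := by
  intro i
  by_cases hi : i = μ
  · subst hi
    simp [abs_of_nonneg ht]
  · simp [Pi.single_eq_of_ne hi, ht]

/-- (S1‴) … and so is the step back. [folklore] -/
theorem within_sub_single (x : Pt d) (μ : Fin d) {t : ℤ} (ht : 0 ≤ t) : Within t x (x - Pi.single μ t) := by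
  have h := (within_add_single (x - Pi.single μ t) μ ht).symm
  rwa [sub_add_cancel] at h

end Collars

variable {P : Params}

/-- (S2) Pushed-forward collars are monotone in the width. [folklore] -/
theorem collar_mono (s : ℕ) (c : Pt P.d) {w w' : ℤ} (h : w ≤ w') :
    cover P '' cubeExt s c w ⊆ cover P '' cubeExt s c w' :=
  Set.image_mono (cubeExt_mono s c h)

/-- ★ (S3) **COLLARS ON THE TORUS**: if `π x` lies in `π(cubeExt s c w)` and `x'` is within `t` of `x` on the cover, then `π x'` lies in
`π(cubeExt s c (w + t))` — deck transformations are isometries, so no representative needs choosing. [folklore] -/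
theorem cover_mem_collar_of_within (s : ℕ) (c : Pt P.d) {w t : ℤ} {x x' : Pt P.d}
    (hx : cover P x ∈ cover P '' cubeExt s c w) (h : Within t x x') :
    cover P x' ∈ cover P '' cubeExt s c (w + t) := by
  obtain ⟨y, hy, hyx⟩ := hx
  obtain ⟨v, hv⟩ := (cover_eq_cover_iff y x).1 hyx
  refine ⟨x' - pmul (per P) v, mem_cubeExt_of_within s c hy ?_, ?_⟩
  · intro i
    have h1 := h i
    have hvi : x i = y i + pmul (per P) v i := by rw [hv]; rfl
    rw [show y i - (x' - pmul (per P) v) i = x i - x' i by rw [Pi.sub_apply, hvi]; ring]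
    exact h1
  · have h1 := cover_add_pmul (P := P) (x' - pmul (per P) v) v
    rw [sub_add_cancel] at h1
    exact h1.symm

/-- (S4′) One lattice step forward costs one unit of collar. [folklore] -/
theorem shift_mem_collar (s : ℕ) (c : Pt P.d) {w : ℤ} {a : Site P 0} (μ : Fin P.d) (ha : a ∈ cover P '' cubeExt s c w) :
    a.shift μ ∈ cover P '' cubeExt s c (w + 1) := by
  rw [← cover_lift a] at ha
  have h := cover_mem_collar_of_within s c ha (within_add_single (lift P a) μ zero_le_one)
  rwa [B15Claim189CubePin.cover_add_single, cover_lift] at h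

/-- (S4″) One lattice step backward costs one unit of collar. [folklore] -/
theorem mem_collar_of_shift_mem (s : ℕ) (c : Pt P.d) {w : ℤ} {a : Site P 0} (μ : Fin P.d)
    (ha : a.shift μ ∈ cover P '' cubeExt s c w) : a ∈ cover P '' cubeExt s c (w + 1) := by
  have ha' : cover P (lift P a + Pi.single μ 1) ∈ cover P '' cubeExt s c w := by rwa [B15Claim189CubePin.cover_add_single, cover_lift]
  have h := cover_mem_collar_of_within s c ha' (within_add_single (lift P a) μ zero_le_one).symm
  rwa [cover_lift] at h

/-- (S5) Unit steps are injective on every torus `T^{(j)}`. [folklore] -/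
theorem eq_of_shift_eq {j : ℕ} {y y' : Site P j} {μ : Fin P.d} (h : y.shift μ = y'.shift μ) : y = y' := by
  have h1 := congrArg (fun z : Site P j => z.unshift μ) h
  simpa only [B10StarCount.unshift_shift] using h1

/-! ## §2 Blocks: same label ⇒ one `L^j`-cube; the representative; the `L^j`-translate of a block -/

/-- (B1) Two fine sites with the same `j`-block label have standard lifts within `L^j − 1` of each other (r11 `val_blockIter`; standing
range `j ≤ m + K`). [cite: Balaban1987RG1, (0.1) p.251] -/
theorem within_lift_of_blockIter_eq {j : ℕ} (hj : j ≤ P.m + P.K) {a a' : Site P 0} (h : blockIter j a = blockIter j a') :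
    Within (((P.L ^ j : ℕ) : ℤ) - 1) (lift P a) (lift P a') := by
  intro i
  have hq : 0 < P.L ^ j := pow_pos P.L_pos j
  have hd : (a i).val / P.L ^ j = (a' i).val / P.L ^ j := by
    rw [← val_blockIter hj a i, ← val_blockIter hj a' i, h]
  have h1 := Nat.div_add_mod (a i).val (P.L ^ j)
  have h2 := Nat.div_add_mod (a' i).val (P.L ^ j)
  have h3 := Nat.mod_lt (a i).val hq
  have h4 := Nat.mod_lt (a' i).val hq
  rw [hd] at h1
  simp only [lift]
  generalize P.L ^ j * ((a' i).val / P.L ^ j) = t at h1 h2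
  generalize P.L ^ j = q at h1 h2 h3 h4 ⊢
  rw [abs_le]
  constructor <;> omega

/-- (B2) The representative `embIter j y` of the `j`-block of `y` has label `y` (`TorusGeometry.blockOf_emb` iterated).
[cite: Balaban1987RG1, (0.1) p.251] -/
theorem blockIter_embIter : ∀ {j : ℕ}, j ≤ P.m + P.K → ∀ y : Site P j, blockIter j (embIter j y) = y
  | 0, _, _ => rfl
  | j + 1, hj, y => by
      rw [blockIter_succ]
      show blockOf (blockIter j (embIter j (emb y))) = y
      rw [blockIter_embIter (by omega) (emb y), Site.blockOf_emb hj]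

/-- (B3₁) The block label as a cast of the integer quotient. [cite: Balaban1987RG1, (0.1) p.251] -/
theorem blockIter_apply_eq_natCast {j : ℕ} (hj : j ≤ P.m + P.K) (b : Site P 0) (ν : Fin P.d) :
    blockIter j b ν = (((b ν).val / P.L ^ j : ℕ) : ZMod (P.sitesPerDir j)) := by
  rw [← val_blockIter hj b ν, ZMod.natCast_zmod_val]

/-- ★ (B3) **THE `L^j`-TRANSLATE OF A BLOCK IS THE BLOCK OF THE SHIFTED LABEL**: `B^j(π(x + L^j e_μ)) = B^j(π x) + e_μ` on `T^{(j)}`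
(the one `ZMod` computation: `N₀ = L^j N_j`, `((v + L^j) mod N₀) / L^j ≡ v / L^j + 1 (mod N_j)`). [cite: Balaban1987RG1, (0.1) p.251] -/
theorem blockIter_cover_add_single {j : ℕ} (hj : j ≤ P.m + P.K) (x : Pt P.d) (μ : Fin P.d) :
    blockIter j (cover P (x + Pi.single μ ((P.L ^ j : ℕ) : ℤ))) = (blockIter j (cover P x)).shift μ := by
  set a := cover P x with ha
  obtain ⟨v, hv⟩ := (cover_eq_cover_iff (lift P a) x).1 (by rw [cover_lift])
  have hred : cover P (x + Pi.single μ ((P.L ^ j : ℕ) : ℤ)) = cover P (lift P a + Pi.single μ ((P.L ^ j : ℕ) : ℤ)) := by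
    calc cover P (x + Pi.single μ ((P.L ^ j : ℕ) : ℤ))
        = cover P (lift P a + Pi.single μ ((P.L ^ j : ℕ) : ℤ) + pmul (per P) v) := by rw [hv, add_right_comm]
      _ = cover P (lift P a + Pi.single μ ((P.L ^ j : ℕ) : ℤ)) := cover_add_pmul _ _
  rw [hred]
  have hN : P.sitesPerDir 0 = P.L ^ j * P.sitesPerDir j := by
    unfold Params.sitesPerDir
    rw [Nat.sub_zero, mul_left_comm, ← pow_add, Nat.add_sub_cancel' hj]
  have hq : 0 < P.L ^ j := pow_pos P.L_pos j
  funext ν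
  rw [Site.shift_apply]
  by_cases hν : ν = μ
  · subst hν
    rw [if_pos rfl, blockIter_apply_eq_natCast hj, blockIter_apply_eq_natCast hj a ν]
    have hc : cover P (lift P a + Pi.single ν ((P.L ^ j : ℕ) : ℤ)) ν = (((a ν).val + P.L ^ j : ℕ) : ZMod (P.sitesPerDir 0)) := by
      simp only [cover_apply, Pi.add_apply, Pi.single_eq_same, lift]
      push_cast
      rfl
    rw [hc, ZMod.val_natCast]
    generalize (a ν).val = u
    rw [hN, Nat.mod_mul_right_div_self, Nat.add_div_right _ hq, ZMod.natCast_mod]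
    push_cast
    rfl
  · rw [if_neg hν, blockIter_apply_eq_natCast hj, blockIter_apply_eq_natCast hj a ν]
    have hc : cover P (lift P a + Pi.single μ ((P.L ^ j : ℕ) : ℤ)) ν = a ν := by
      simp only [cover_apply, Pi.add_apply, Pi.single_eq_of_ne hν, add_zero, lift]
      push_cast
      exact ZMod.natCast_zmod_val (a ν)
    rw [hc]

/-- (B3′) … read backwards: the block label of `π(x − L^j e_μ)`, shifted, is the label of `π x`. [cite: Balaban1987RG1, (0.1) p.251] -/
theorem blockIter_cover_sub_single {j : ℕ} (hj : j ≤ P.m + P.K) (x : Pt P.d) (μ : Fin P.d) :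
    (blockIter j (cover P (x - Pi.single μ ((P.L ^ j : ℕ) : ℤ)))).shift μ = blockIter j (cover P x) := by
  have h := blockIter_cover_add_single hj (x - Pi.single μ ((P.L ^ j : ℕ) : ℤ)) μ
  rw [sub_add_cancel] at h
  exact h.symm

/-! ## §3 The averaging inputs `feeds` ∕ `inputs (near 𝐁_k(Ω))` are carried by a `(4L^k − 1)`-collar of `Ω` -/

/-- (F1) Every fine bond of `feeds j b` ((2.11): the bonds the `j`-fold average at `b` may read) has its source within `2L^j − 2`, on the
cover, of a point of the `j`-block of `b₋` (induction over `mem_feeds_succ`; the step `b₊ = b₋ + e` is the `L^{j}`-translate (B3′)).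
[cite: Balaban1988Convergent, (2.11) p.256] -/
theorem feeds_witness {j : ℕ} (hj : j ≤ P.m + P.K) : ∀ (b : PBond P j) (b₀ : PBond P 0), b₀ ∈ feeds j b →
    ∃ x x₀ : Pt P.d, blockIter j (cover P x) = b.src ∧ cover P x₀ = b₀.src ∧ Within (2 * ((P.L ^ j : ℕ) : ℤ) - 2) x x₀ := by
  induction j with
  | zero =>
      intro b b₀ h
      rw [feeds_zero, Set.mem_singleton_iff] at h
      subst h
      exact ⟨lift P b₀.src, lift P b₀.src, by rw [blockIter_zero, cover_lift], cover_lift _,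
        Within.refl (by norm_num) _⟩
  | succ j ih =>
      intro c b₀ h
      obtain ⟨b', hb', hb₀⟩ := mem_feeds_succ.1 h
      obtain ⟨x, x₀, hx, hx₀, hw⟩ := ih (by omega) b' b₀ hb₀
      have hpow : 2 * P.L ^ j ≤ P.L ^ (j + 1) := by
        rw [pow_succ, mul_comm]
        exact Nat.mul_le_mul_left _ P.hL.2
      rcases hb' with hsrc | htgt
      · refine ⟨x, x₀, ?_, hx₀, Within.mono (by omega) hw⟩
        rw [blockIter_succ, hx, hsrc]
      · set e : Pt P.d := Pi.single c.dir ((P.L ^ (j + 1) : ℕ) : ℤ) with he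
        have h1 := blockIter_cover_sub_single hj x c.dir
        have h2 : blockIter (j + 1) (cover P x) = c.src.shift c.dir := by rw [blockIter_succ, hx, htgt]; rfl
        rw [h2, ← he] at h1
        have h1' : blockIter (j + 1) (cover P (x - e)) = c.src := eq_of_shift_eq h1
        have h3 : Within ((P.L ^ (j + 1) : ℕ) : ℤ) (x - e) x :=
          (within_sub_single x c.dir (t := ((P.L ^ (j + 1) : ℕ) : ℤ)) (by positivity)).symm
        exact ⟨x - e, x₀, h1', hx₀, Within.mono (by omega) (h3.triangle hw)⟩

/-- (F2) Hence: if the representative of the `j`-block of `b₋` OR of `b₊` lies in `π(cubeExt s c w)`, every fine bond of `feeds j b` has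
its source in `π(cubeExt s c (w + 4L^j − 3))`. [cite: Balaban1988Convergent, (2.11) p.256] -/
theorem src_mem_collar_of_feeds {j : ℕ} (hj : j ≤ P.m + P.K) (s : ℕ) (c : Pt P.d) {w : ℤ} {b : PBond P j} {b₀ : PBond P 0}
    (hb₀ : b₀ ∈ feeds j b)
    (hanchor : embIter j b.src ∈ cover P '' cubeExt s c w ∨ embIter j b.tgt ∈ cover P '' cubeExt s c w) :
    b₀.src ∈ cover P '' cubeExt s c (w + 4 * ((P.L ^ j : ℕ) : ℤ) - 3) := by
  obtain ⟨x, x₀, hx, hx₀, hw⟩ := feeds_witness hj b b₀ hb₀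
  have hq : 1 ≤ P.L ^ j := Nat.one_le_pow _ _ P.L_pos
  have key : cover P x ∈ cover P '' cubeExt s c (w + 2 * ((P.L ^ j : ℕ) : ℤ) - 1) := by
    rcases hanchor with h | h
    · have hblk : blockIter j (embIter j b.src) = blockIter j (cover P x) := by rw [blockIter_embIter hj, hx]
      have hW := within_lift_of_blockIter_eq hj hblk
      have h' : cover P (lift P (embIter j b.src)) ∈ cover P '' cubeExt s c w := by rwa [cover_lift]
      have h2 := cover_mem_collar_of_within s c h' hW
      rw [cover_lift] at h2
      exact collar_mono s c (by omega) h2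
    · set x₁ : Pt P.d := lift P (embIter j b.tgt) - Pi.single b.dir ((P.L ^ j : ℕ) : ℤ) with hx₁
      have h1 := blockIter_cover_sub_single hj (lift P (embIter j b.tgt)) b.dir
      rw [cover_lift, blockIter_embIter hj, ← hx₁, show b.tgt = b.src.shift b.dir from rfl] at h1
      have hblk : blockIter j (cover P x₁) = blockIter j (cover P x) := by
        rw [hx]; exact eq_of_shift_eq h1
      have h' : cover P (lift P (embIter j b.tgt)) ∈ cover P '' cubeExt s c w := by rwa [cover_lift]
      have h2 : cover P x₁ ∈ cover P '' cubeExt s c (w + ((P.L ^ j : ℕ) : ℤ)) :=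
        cover_mem_collar_of_within s c h'
          (within_sub_single (lift P (embIter j b.tgt)) b.dir (t := ((P.L ^ j : ℕ) : ℤ)) (by positivity))
      have hW := within_lift_of_blockIter_eq hj hblk
      have h2' : cover P (lift P (cover P x₁)) ∈ cover P '' cubeExt s c (w + ((P.L ^ j : ℕ) : ℤ)) := by
        rw [cover_lift]; exact h2
      have h3 := cover_mem_collar_of_within s c h2' hW
      rw [cover_lift] at h3
      exact collar_mono s c (by omega) h3
  have h4 := cover_mem_collar_of_within s c key hw
  rw [hx₀] at h4
  exact collar_mono s c (by omega) h4

/-- (F3) A positive layer `Γ_{i+1}` of `𝐁_k(Ω)`, `Ω = π(cubeExt s c w)`: every fine bond feeding a bond that meets it has its source in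
`π(cubeExt s c (w + 4L^k − 3))` (`Bj_subset_pts`: `Γ_{i+1} ⊆ Ω^{(i+1)}`; empty above `k`). [cite: Balaban1988Convergent, (2.2) p.255, (2.11) p.256] -/
theorem src_mem_collar_of_feeds_Bj_succ {k : ℕ} (hk : k ≤ P.m + P.K) {M₁ : ℕ} (hM : 1 ≤ M₁) (s : ℕ) (c : Pt P.d) (w : ℤ)
    {i : ℕ} {b : PBond P (i + 1)} {b₀ : PBond P 0}
    (hb : b ∈ bondsOf (Bj M₁ (cover P '' cubeExt s c w) k (i + 1))) (hb₀ : b₀ ∈ feeds (i + 1) b) :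
    b₀.src ∈ cover P '' cubeExt s c (w + 4 * ((P.L ^ k : ℕ) : ℤ) - 3) := by
  by_cases hik : k < i + 1
  · rw [Bj_of_gt hik] at hb
    simp [bondsOf] at hb
  rw [not_lt] at hik
  have hsub := Bj_subset_pts (Ω := cover P '' cubeExt s c w) hM (j := k) (Nat.succ_pos i)
  have hanchor : embIter (i + 1) b.src ∈ cover P '' cubeExt s c w ∨ embIter (i + 1) b.tgt ∈ cover P '' cubeExt s c w := by
    rcases hb with h | h
    · exact Or.inl (mem_pts.1 (hsub h))
    · exact Or.inr (mem_pts.1 (hsub h))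
  have h1 := src_mem_collar_of_feeds (by omega) s c hb₀ hanchor
  have hpow : P.L ^ (i + 1) ≤ P.L ^ k := Nat.pow_le_pow_right P.L_pos hik
  exact collar_mono s c (by omega) h1

/-- (F4) The corner of a plaquette one of whose bonds starts in a collar lies in the next collar. [folklore] -/
theorem plaq_src_mem_collar (s : ℕ) (c : Pt P.d) {w : ℤ} {p : Plaq P 0} {b : PBond P 0} (hb : b ∈ plaqBonds p)
    (h : b.src ∈ cover P '' cubeExt s c w) : p.src ∈ cover P '' cubeExt s c (w + 1) := by
  rcases mem_plaqBonds.1 hb with rfl | rfl | rfl | rfl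
  · exact collar_mono s c (by omega) h
  · exact mem_collar_of_shift_mem s c p.μ h
  · exact mem_collar_of_shift_mem s c p.ν h
  · exact collar_mono s c (by omega) h

/-- (F4′) Both endpoints of every bond of a plaquette whose corner lies in a collar lie two units further out. [folklore] -/
theorem plaqBonds_ends_mem_collar (s : ℕ) (c : Pt P.d) {w : ℤ} {p : Plaq P 0} (hp : p.src ∈ cover P '' cubeExt s c w)
    {b : PBond P 0} (hb : b ∈ plaqBonds p) :
    b.src ∈ cover P '' cubeExt s c (w + 2) ∧ b.tgt ∈ cover P '' cubeExt s c (w + 2) := by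
  have h1 : ∀ μ : Fin P.d, p.src.shift μ ∈ cover P '' cubeExt s c (w + 1) := fun μ => shift_mem_collar s c μ hp
  have h2 : ∀ μ ν : Fin P.d, (p.src.shift μ).shift ν ∈ cover P '' cubeExt s c (w + 2) := fun μ ν => by
    have := shift_mem_collar s c ν (h1 μ); rwa [show w + 1 + 1 = w + 2 by ring] at this
  rcases mem_plaqBonds.1 hb with rfl | rfl | rfl | rfl
  · exact ⟨collar_mono s c (by omega) hp, collar_mono s c (by omega) (h1 p.μ)⟩
  · exact ⟨collar_mono s c (by omega) (h1 p.μ), h2 p.μ p.ν⟩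
  · exact ⟨collar_mono s c (by omega) (h1 p.ν), h2 p.ν p.μ⟩
  · exact ⟨collar_mono s c (by omega) hp, collar_mono s c (by omega) (h1 p.ν)⟩

/-- ★ (F5) **THE INPUTS OF THE NEAR DATA OF `𝐁_k(Ω)`**, `Ω = π(cubeExt s c w)`, `0 < k ≤ m + K`, `1 ≤ M₁`: every fine bond of
`inputs (near 𝐁_k(Ω))` has its source in `π(cubeExt s c (w + 4L^k − 1))` — layers `j ≥ 1` by (F3); layer `0` = the near `Γ₀`-sites,
`Γ₀ = Ω₁ᶜ` (`Bj_zero`): a site of a plaquette having a bond inside `Ω₁ ⊆ Ω` (`maxDomT_subset`), or an endpoint of a feeding bond.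
[cite: Balaban1988Convergent, (2.2) p.255, (2.11) p.256] -/
theorem src_mem_collar_of_inputs_near_Bj {k : ℕ} (hk0 : 0 < k) (hk : k ≤ P.m + P.K) {M₁ : ℕ} (hM : 1 ≤ M₁)
    (s : ℕ) (c : Pt P.d) (w : ℤ) {b₀ : PBond P 0}
    (hb₀ : b₀ ∈ inputs (near (Bj M₁ (cover P '' cubeExt s c w) k))) :
    b₀.src ∈ cover P '' cubeExt s c (w + 4 * ((P.L ^ k : ℕ) : ℤ) - 1) := by
  have hLk : 2 ≤ P.L ^ k :=
    le_trans P.hL.2 (by simpa using Nat.pow_le_pow_right P.L_pos hk0)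
  obtain ⟨j, b, hb, hfe⟩ := mem_inputs.1 hb₀
  cases j with
  | succ i =>
      rw [near_succ] at hb
      exact collar_mono s c (by omega) (src_mem_collar_of_feeds_Bj_succ hk hM s c w hb hfe)
  | zero =>
      rw [near_zero] at hb
      rw [feeds_zero, Set.mem_singleton_iff] at hfe
      subst hfe
      have hY : ∀ y ∈ nearSites (Bj M₁ (cover P '' cubeExt s c w) k),
          y ∈ cover P '' cubeExt s c (w + 4 * ((P.L ^ k : ℕ) : ℤ) - 2) := by
        intro y hy
        obtain ⟨-, b', hyb', hcase⟩ := hy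
        rcases hcase with ⟨p, hb'p, hp⟩ | hpos
        · obtain ⟨b'', hb''p, hb''E⟩ := Set.not_subset.1 hp
          have hsrc : b''.src ∈ cover P '' cubeExt s c w := by
            have h1 : b''.src ∉ Bj M₁ (cover P '' cubeExt s c w) k 0 := fun h => hb''E (Or.inl h)
            rw [Bj_zero hk0, Set.mem_compl_iff, not_not] at h1
            exact maxDomT_subset hM _ 1 h1
          have hq := plaq_src_mem_collar s c hb''p hsrc
          have hends := plaqBonds_ends_mem_collar s c hq hb'p
          rcases hyb' with rfl | rfl
          · exact collar_mono s c (by omega) hends.1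
          · exact collar_mono s c (by omega) hends.2
        · obtain ⟨i, b'', hb'', hfe'⟩ := mem_inputsPos.1 hpos
          have h1 := src_mem_collar_of_feeds_Bj_succ hk hM s c w hb'' hfe'
          rcases hyb' with rfl | rfl
          · exact collar_mono s c (by omega) h1
          · have h2 := shift_mem_collar s c b'.dir h1
            exact collar_mono s c (by omega) h2
      rcases hb with h | h
      · exact collar_mono s c (by omega) (hY _ h)
      · have h2 := mem_collar_of_shift_mem s c b₀.dir (hY _ h)
        exact collar_mono s c (by omega) h2

end Summit.QuantumFields.YangMills.Theorems.N21ReadSetSupport
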